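import Summits.NavierStokesRegularity.NavierStokesRegularity.Theorems.TypeICertificateLadderTargetStretchingSlice
import Summits.NavierStokesRegularity.NavierStokesRegularity.Theorems.TypeICertificateLadderRungReynoldsOneAprioriDecay
import Literature.Analysis.FluidPDE.ClassicalL2Stability
import HarnessLib

/-!
# Crux `Target` = `TypeICertificateLadder.NoTypeIBlowup` (stmt-NavierStokesRegularity-1217), line
# `depletion-ladder`: the enstrophy slab inequality under a per-slice production bound

`--supports stmt-NavierStokesRegularity-1217` (line `depletion-ladder`; per-solution form of stub S2,
file 2/3; slice step `DepletionLadder.stretching_enstrophy_slice`).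

On a Tao-class slab `[0, T] × ℝ³`, if at every interior time the enstrophy production of the
solution obeys `∫⟪ω, Du ω⟫(t) ≤ L(t) · ‖ω(t)‖₂ · ‖∇ω(t)‖₂` for some function `L` with
`∫₀ˢ L(t)² dt < ∞`, then

  `∫ ‖curl u(s)‖² ≤ exp( (2ν)⁻¹ ∫₀ˢ L(t)² dt ) · ∫ ‖curl u(0)‖²`   (`lintegral_curl_sq_le_exp_stretching`).

This is `DepletionLadder.lintegral_curl_sq_le_exp_depleted` (p470803) with the universal depletion
hypothesis `L ≡ κ‖u(t)‖_∞` replaced by an arbitrary per-slice bound; with `L(t) = γ√(ν/(T−t))` near a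
putative blow-up time it yields `‖ω(t)‖₂² ≲ (T−t)^{−γ²/2}` (companion file), contradicting the
`H¹` blow-up rate when `γ < 1`.

WHAT THIS IS NOT: bookkeeping (the `L²` balance of the vorticity family + Grönwall in `ℝ≥0∞`).
[folklore]

References: Lemarié-Rieusset 2016, Thm. 11.2; Robinson–Rodrigo–Sadowski 2016, Lemma 8.16.
-/

noncomputable section

open Set Filter Topology MeasureTheory
open scoped RealInnerProductSpace ENNReal NNReal Laplacian ContDiff
open Literature.Analysis.FluidPDE

namespace Summit.NavierStokesRegularity.NavierStokesRegularity.Theorems.DepletionLadder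

-- the problem directory repeats the summit name (`NavierStokesRegularity/NavierStokesRegularity`)
set_option linter.dupNamespace false

open Summit.NavierStokesRegularity.NavierStokesRegularity.Theorems.RungReynoldsOne

/-- **The enstrophy slab inequality under a per-slice production bound.** For a classical
solution of the unforced Navier–Stokes system with viscosity `ν > 0` on `[0, T] × ℝ³` with `u`,
`∂ₜu` in Tao's `L²`-Sobolev class, a function `L : ℝ → ℝ` with
`∫⟪curl u(t), Du(t) curl u(t)⟫ ≤ L(t) √(∫‖curl u(t)‖²) √(∫|∇curl u(t)|²_F)` for all `t ∈ (0, T)`, and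
`0 < s ≤ T` with `∫₀ˢ L(t)² dt < ∞`:
`∫ ‖curl u(s)‖² ≤ exp((2ν)⁻¹ ∫₀ˢ L(t)² dt) ∫ ‖curl u(0)‖²` (lower Lebesgue integrals). [folklore] -/
theorem lintegral_curl_sq_le_exp_stretching {ν T : ℝ} (hν : 0 < ν) (hT : 0 < T)
    {u : ℝ → EuclideanSpace ℝ (Fin 3) → EuclideanSpace ℝ (Fin 3)}
    {p : ℝ → EuclideanSpace ℝ (Fin 3) → ℝ} (hsol : IsClassicalNSSolutionOn (Icc 0 T) ν 0 u p)
    (hu : HasBoundedSobolevNormsOn (Icc 0 T) u)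
    (hut : HasBoundedSobolevNormsOn (Icc 0 T) (timeDerivWithin (Icc 0 T) u))
    {L : ℝ → ℝ}
    (hJ : ∀ t ∈ Ioo 0 T, ∫ x, ⟪curl (u t) x, fderiv ℝ (u t) x (curl (u t) x)⟫ ≤
      L t * Real.sqrt (∫ x, ‖curl (u t) x‖ ^ 2) *
        Real.sqrt (∫ x, frobeniusNormSq (fderiv ℝ (curl (u t)) x)))
    {s : ℝ} (hs : s ∈ Ioc 0 T)
    (hA : ∫⁻ t in Ioo 0 s, ENNReal.ofReal (L t ^ 2) ≠ ⊤) :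
    ∫⁻ x, ‖curl (u s) x‖ₑ ^ 2 ≤
      ENNReal.ofReal (Real.exp ((2 * ν)⁻¹ *
          (∫⁻ t in Ioo 0 s, ENNReal.ofReal (L t ^ 2)).toReal)) *
        ∫⁻ x, ‖curl (u 0) x‖ₑ ^ 2 := by
  have hU : UniqueDiffOn ℝ (Icc 0 T) := uniqueDiffOn_Icc hT
  set W : ℝ → EuclideanSpace ℝ (Fin 3) → EuclideanSpace ℝ (Fin 3) :=
    timeDerivWithin (Icc 0 T) u with hW
  have hWsm : IsSmoothSpaceTimeOn (Icc 0 T) W := hsol.smooth_velocity.timeDerivWithin hU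
  -- the vorticity family and its time derivative
  have hwsm : IsSmoothSpaceTimeOn (Icc 0 T) (vorticity u) :=
    hsol.smooth_velocity.isSmoothSpaceTimeOn_vorticity hU
  have hwt : ∀ t ∈ Icc 0 T, ∀ x, timeDerivWithin (Icc 0 T) (vorticity u) t x = curl (W t) x :=
    fun t ht x => (hsol.smooth_velocity.curl_timeDerivWithin_of_uniqueDiffOn hU ht x).symm
  -- uniform bounds on the slab
  obtain ⟨B₀, hB₀0, hB₀⟩ := exists_forall_norm_le_of_hasBoundedSobolevNormsOn hsol hu
  obtain ⟨B₁, hB₁0, hB₁⟩ := exists_forall_norm_fderiv_le_of_hasBoundedSobolevNormsOn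
    (fun t ht => (hsol.contDiff_velocity ht).of_le (by norm_cast)) hu
  obtain ⟨C₁, hC₁⟩ := hu 1
  obtain ⟨C₂, hC₂⟩ := hu 2
  obtain ⟨C₃, hC₃⟩ := hu 3
  obtain ⟨E₁, hE₁⟩ := hut 1
  -- `L²` bounds of the vorticity and of its time derivative
  have hw0 : ∀ t ∈ Icc 0 T, ∫⁻ x, ‖vorticity u t x‖ₑ ^ 2 ≤ 6 * C₁ := by
    intro t ht
    calc ∫⁻ x, ‖vorticity u t x‖ₑ ^ 2 ≤ ∫⁻ x, 6 * ‖iteratedFDeriv ℝ 1 (u t) x‖ₑ ^ 2 :=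
          lintegral_mono fun x => enorm_curl_sq_le_six_mul (u t) x
      _ = 6 * ∫⁻ x, ‖iteratedFDeriv ℝ 1 (u t) x‖ₑ ^ 2 := lintegral_const_mul' _ _ (by norm_num)
      _ ≤ 6 * C₁ := by gcongr; exact hC₁ t ht
  have hw1 : ∀ t ∈ Icc 0 T,
      ∫⁻ x, ‖timeDerivWithin (Icc 0 T) (vorticity u) t x‖ₑ ^ 2 ≤ 6 * E₁ := by
    intro t ht
    calc ∫⁻ x, ‖timeDerivWithin (Icc 0 T) (vorticity u) t x‖ₑ ^ 2
        = ∫⁻ x, ‖curl (W t) x‖ₑ ^ 2 := lintegral_congr fun x => by rw [hwt t ht x]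
      _ ≤ ∫⁻ x, 6 * ‖iteratedFDeriv ℝ 1 (W t) x‖ₑ ^ 2 :=
          lintegral_mono fun x => enorm_curl_sq_le_six_mul (W t) x
      _ = 6 * ∫⁻ x, ‖iteratedFDeriv ℝ 1 (W t) x‖ₑ ^ 2 := lintegral_const_mul' _ _ (by norm_num)
      _ ≤ 6 * E₁ := by gcongr; exact hE₁ t ht
  -- the `L²` balance of the vorticity family
  obtain ⟨hΦint, -, hZb⟩ := hwsm.l2_balance hT (C₀ := 6 * C₁) (C₁ := 6 * E₁) hw0 hw1
  set Z : ℝ → ℝ := fun t => ∫ x, ‖vorticity u t x‖ ^ 2 with hZ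
  set Φ : ℝ → ℝ := fun t => ∫ x, 2 * ⟪vorticity u t x,
    timeDerivWithin (Icc 0 T) (vorticity u) t x⟫ with hΦ
  -- integrability and `ofReal` bookkeeping of the enstrophy slices
  have cvort : ∀ t ∈ Icc 0 T, Continuous (vorticity u t) := fun t ht =>
    (hwsm.contDiff_slice ht).continuous
  have hvort_lt : ∀ t ∈ Icc 0 T, ∫⁻ x, ‖vorticity u t x‖ₑ ^ 2 < ⊤ := fun t ht =>
    (hw0 t ht).trans_lt (ENNReal.mul_lt_top (by norm_num) ENNReal.coe_lt_top)
  have isq : ∀ t ∈ Icc 0 T, Integrable (fun x => ‖vorticity u t x‖ ^ 2) volume := fun t ht =>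
    integrable_sq_norm_of_lintegral_lt_top (cvort t ht) (hvort_lt t ht)
  have hZ0 : ∀ t, 0 ≤ Z t := fun t => integral_nonneg fun x => sq_nonneg _
  have hZeq : ∀ t ∈ Icc 0 T, ENNReal.ofReal (Z t) = ∫⁻ x, ‖curl (u t) x‖ₑ ^ 2 := fun t ht => by
    rw [hZ]
    exact ofReal_integral_sq_norm (isq t ht)
  -- THE SLICE BOUND at interior times: `Φ t ≤ (2ν)⁻¹ L(t)² Z t`
  have hslice : ∀ t ∈ Ioo 0 T, Φ t ≤ (2 * ν)⁻¹ * L t ^ 2 * Z t := by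
    intro t ht
    have htI : t ∈ Icc 0 T := Ioo_subset_Icc_self ht
    have hZt : ∀ x, curl (W t) x = ν • (Δ (curl (u t))) x - convect (u t) (curl (u t)) x +
        convect (curl (u t)) (u t) x := by
      intro x
      have h := hsol.curl_timeDerivWithin_eq hU htI x
      rw [show ((0 : ℝ → EuclideanSpace ℝ (Fin 3) → EuclideanSpace ℝ (Fin 3)) t) = 0 from rfl,
        curl_zero, add_zero] at h
      exact h
    have h1 : ∫⁻ x, ‖iteratedFDeriv ℝ 1 (u t) x‖ₑ ^ 2 < ⊤ := (hC₁ t htI).trans_lt ENNReal.coe_lt_top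
    have h2 : ∫⁻ x, ‖iteratedFDeriv ℝ 2 (u t) x‖ₑ ^ 2 < ⊤ := (hC₂ t htI).trans_lt ENNReal.coe_lt_top
    have h3 : ∫⁻ x, ‖iteratedFDeriv ℝ 3 (u t) x‖ₑ ^ 2 < ⊤ := (hC₃ t htI).trans_lt ENNReal.coe_lt_top
    have hsl := stretching_enstrophy_slice hν (hsol.contDiff_velocity htI) (hsol.divFree t htI)
      hZt (hB₀ t htI) (hB₁ t htI) h1 h2 h3 (hJ t ht)
    -- rewrite `Φ t` in terms of `curl (W t)`
    have hΦt : Φ t = 2 * ∫ x, ⟪curl (u t) x, curl (W t) x⟫ := by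
      rw [hΦ]
      simp only
      rw [← integral_const_mul]
      refine integral_congr_ae (Eventually.of_forall fun x => ?_)
      simp only [vorticity_apply, hwt t htI x]
    have hZt' : ∫ x, ‖curl (u t) x‖ ^ 2 = Z t := by
      rw [hZ]
      simp only [vorticity_apply]
    calc Φ t = 2 * ∫ x, ⟪curl (u t) x, curl (W t) x⟫ := hΦt
      _ ≤ 2 * (L t ^ 2 / (4 * ν) * ∫ x, ‖curl (u t) x‖ ^ 2) :=
          mul_le_mul_of_nonneg_left hsl (by norm_num)
      _ = (2 * ν)⁻¹ * L t ^ 2 * Z t := by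
          rw [hZt']
          field_simp
          ring
  -- Grönwall in `ℝ≥0∞`
  set φE : ℝ → ℝ≥0∞ := fun t => ENNReal.ofReal (Z t) with hφE
  set kν : ℝ := (2 * ν)⁻¹ with hkν
  have hk0 : 0 ≤ kν := by positivity
  set aE : ℝ → ℝ≥0∞ := fun t => ENNReal.ofReal kν * ENNReal.ofReal (L t ^ 2) with haE
  have hM : ∀ t ∈ Icc 0 s, φE t ≤ 6 * C₁ := fun t ht => by
    rw [hφE]
    simp only
    rw [hZeq t ⟨ht.1, ht.2.trans hs.2⟩]
    exact hw0 t ⟨ht.1, ht.2.trans hs.2⟩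
  have haS : ∫⁻ t in Ioo 0 s, aE t ≠ ⊤ := by
    rw [haE]
    simp only
    rw [lintegral_const_mul' _ _ ENNReal.ofReal_ne_top]
    exact ENNReal.mul_ne_top ENNReal.ofReal_ne_top hA
  have hineq : ∀ t ∈ Icc 0 s, φE t ≤ φE 0 + ∫⁻ τ in Ioo 0 t, aE τ * φE τ := by
    intro t ht
    rcases eq_or_lt_of_le ht.1 with h0 | ht0
    · rw [← h0]; simp
    have htT : t ∈ Ioc 0 T := ⟨ht0, ht.2.trans hs.2⟩
    have hΦt : IntegrableOn Φ (Ioo 0 t) volume := hΦint.mono_set (Ioo_subset_Ioo le_rfl htT.2)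
    have h1 : ENNReal.ofReal (∫ τ in Ioo 0 t, Φ τ) ≤ ∫⁻ τ in Ioo 0 t, ENNReal.ofReal (Φ τ) := by
      calc ENNReal.ofReal (∫ τ in Ioo 0 t, Φ τ) ≤ ENNReal.ofReal (∫ τ in Ioo 0 t, max (Φ τ) 0) :=
            ENNReal.ofReal_le_ofReal (integral_mono hΦt hΦt.pos_part fun τ => le_max_left _ _)
        _ = ∫⁻ τ in Ioo 0 t, ENNReal.ofReal (max (Φ τ) 0) :=
            ofReal_integral_eq_lintegral_ofReal hΦt.pos_part
              (Eventually.of_forall fun τ => le_max_right _ _)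
        _ = ∫⁻ τ in Ioo 0 t, ENNReal.ofReal (Φ τ) := lintegral_congr fun τ => by
            rcases le_total (Φ τ) 0 with h | h
            · rw [max_eq_right h, ENNReal.ofReal_zero, ENNReal.ofReal_of_nonpos h]
            · rw [max_eq_left h]
    have h2 : ∫⁻ τ in Ioo 0 t, ENNReal.ofReal (Φ τ) ≤ ∫⁻ τ in Ioo 0 t, aE τ * φE τ := by
      refine setLIntegral_mono' measurableSet_Ioo fun τ hτ => ?_
      have hτT : τ ∈ Ioo 0 T := ⟨hτ.1, hτ.2.trans_le htT.2⟩
      calc ENNReal.ofReal (Φ τ) ≤ ENNReal.ofReal (kν * L τ ^ 2 * Z τ) :=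
            ENNReal.ofReal_le_ofReal (by simpa [hkν, mul_assoc] using hslice τ hτT)
        _ = aE τ * φE τ := by
            rw [haE, hφE]
            simp only
            rw [ENNReal.ofReal_mul (mul_nonneg hk0 (sq_nonneg _)), ENNReal.ofReal_mul hk0]
    calc φE t = ENNReal.ofReal (Z 0 + ∫ τ in (0 : ℝ)..t, Φ τ) := by
          rw [hφE]
          simp only
          congr 1
          exact hZb t htT
      _ ≤ ENNReal.ofReal (Z 0) + ENNReal.ofReal (∫ τ in (0 : ℝ)..t, Φ τ) := ENNReal.ofReal_add_le
      _ = φE 0 + ENNReal.ofReal (∫ τ in Ioo 0 t, Φ τ) := by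
          rw [intervalIntegral.integral_of_le ht.1, integral_Ioc_eq_integral_Ioo]
      _ ≤ φE 0 + ∫⁻ τ in Ioo 0 t, aE τ * φE τ := by gcongr; exact h1.trans h2
  have hgron := lintegral_gronwall_le (S := s) ENNReal.ofReal_ne_top
    (ENNReal.mul_ne_top (by norm_num) ENNReal.coe_ne_top) hM haS hineq s ⟨hs.1.le, le_rfl⟩
  -- unpack
  have hint_a : (∫⁻ τ in Ioo 0 s, aE τ).toReal =
      kν * (∫⁻ t in Ioo 0 s, ENNReal.ofReal (L t ^ 2)).toReal := by
    rw [haE]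
    simp only
    rw [lintegral_const_mul' _ _ ENNReal.ofReal_ne_top, ENNReal.toReal_mul, ENNReal.toReal_ofReal hk0]
  rw [hint_a] at hgron
  rw [← hZeq s ⟨hs.1.le, hs.2⟩, ← hZeq 0 ⟨le_rfl, hT.le⟩, mul_comm]
  convert hgron using 3

end Summit.NavierStokesRegularity.NavierStokesRegularity.Theorems.DepletionLadder

end
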